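import Summits.AtomisticToContinuum.Crystallization.Theorems.HullExactificationCascadeHullBulkOptimalCut

/-!
# Crux `HcpLandscapeGap` (route `HullExactificationCascade`, stmt-AtomisticToContinuum-12087),
# line `birth`: stub `stub_boundaryLayer` — the boundary layer of a separated set

For `δ > 0`, `ρ ≥ 0` there is `C = C(δ, ρ)` such that for every `δ`-separated `S ⊆ ℝ³`, every
centre `c` and radius `L ≥ 0`, with the window `W = S ∩ B̄_L(c)`:

* (i) the points of `W` at depth `< ρ` (`L − ρ < dist y c ≤ L`) number at most `C (L+1)²`
  (annulus packing `card_mul_pow_add_pow_le_of_separated` if `L − ρ ≥ δ/2`, ball packing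
  `ncard_ball_le` otherwise);
* (ii) for every injective enumeration `x : Fin n → ℝ³` of `W`,
  `2·𝓔_LJ(x) − C (L+1)² ≤ Σ_{y ∈ W} Σ'_{z ∈ S, z ≠ y} V_LJ(|y − z|)`: the site sum at `y = x i`
  splits into the window part `Σ_{k ≠ i} V_LJ(|x i − x k|)` (summing to `2·𝓔_LJ(x)` by double
  counting, `two_mul_interactionEnergy`) and the cross interaction with `S ∖ W`, which is
  `≥ −(1/6) Σ |y − z|⁻⁶ ≥ −(1/6)·1024/(δ³ max(δ, ⌊depth⌋)³)` (`neg_inv_pow_six_le_lennardJones`,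
  `sum_inv_pow_le_of_separated`); summed over depth shells (`card_shell_le`,
  `Σ_k max(δ,k)⁻³ ≤ δ⁻³ + 2`, exactly as in `exists_crossSum_le`) this is a surface term.

All `[folklore]` (Blanc–Lewin 2015, §1.2–§1.3: two far groups of particles attract; the
cut-and-paste surface term).
-/

noncomputable section

namespace Summit.AtomisticToContinuum.Crystallization.Theorems.HcpLandscapeGapBirth

open scoped BigOperators Topology
open Filter Set Metric
open Literature.MathematicalPhysics.StatisticalMechanics
open Summit.AtomisticToContinuum.Crystallization.Theorems.CoarseGrains.Negative.PredicateAPI (E3)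
open Summit.AtomisticToContinuum.Crystallization.Theorems.ExcessDecayLiouville
  (sum_inv_pow_le_of_separated)
open Summit.AtomisticToContinuum.Crystallization.Theorems.ExcessDecayLiouvilleFineGrains
  (card_shell_le card_mul_pow_add_pow_le_of_separated neg_inv_pow_six_le_lennardJones)
open Summit.AtomisticToContinuum.Crystallization.Theorems.HullBulkOptimal
  (summable_lennardJones_site ncard_ball_le)

/-! ## (i) The boundary layer of a ball in a separated set -/

/-- **Layer count.** For a `δ`-separated `S ⊆ ℝ³`, `ρ ≥ 0`, a centre `c` and `L ≥ 0`, the points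
`y ∈ S` with `L − ρ < dist y c ≤ L` number at most
`(24 (ρ+δ) (1+δ/2)²/δ³ + (2ρ/δ + 2)³) (L+1)²`: if `L − ρ ≥ δ/2` the `δ/2`-balls about them are
disjoint and lie in the annulus `L − ρ − δ/2 ≤ |· − c| < L + δ/2`
(`card_mul_pow_add_pow_le_of_separated`), otherwise `L < ρ + δ/2` and the whole ball holds
`≤ (2L/δ + 1)³ ≤ (2ρ/δ + 2)³` points (`ncard_ball_le`). [folklore] -/
theorem ncard_layer_le {S : Set E3} {δ : ℝ} (hδ : 0 < δ)
    (hsep : ∀ a ∈ S, ∀ b ∈ S, a ≠ b → δ ≤ dist a b) {ρ : ℝ} (hρ : 0 ≤ ρ) (c : E3) {L : ℝ}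
    (hL : 0 ≤ L) :
    (({y : E3 | y ∈ S ∧ dist y c ≤ L ∧ L - ρ < dist y c} : Set E3).ncard : ℝ) ≤
      (24 * (ρ + δ) * (1 + δ / 2) ^ 2 / δ ^ 3 + (2 * ρ / δ + 2) ^ 3) * (L + 1) ^ 2 := by
  have hAB : ({y : E3 | y ∈ S ∧ dist y c ≤ L ∧ L - ρ < dist y c} : Set E3) ⊆
      {y : E3 | y ∈ S ∧ dist y c ≤ L} := fun y hy => ⟨hy.1, hy.2.1⟩
  have hBfin : ({y : E3 | y ∈ S ∧ dist y c ≤ L} : Set E3).Finite :=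
    finite_of_forall_le_dist_of_subset_closedBall hδ
      (fun p hp q hq hpq => hsep p hp.1 q hq.1 hpq) (c := c) (R := L)
      (fun p hp => mem_closedBall.2 hp.2)
  have hAfin := hBfin.subset hAB
  have h1 : 0 ≤ 24 * (ρ + δ) * (1 + δ / 2) ^ 2 / δ ^ 3 := by positivity
  have h2 : 0 ≤ (2 * ρ / δ + 2) ^ 3 := by positivity
  have hL1 : 1 ≤ (L + 1) ^ 2 := by nlinarith
  by_cases hcase : δ / 2 ≤ L - ρ
  · -- annulus packing
    rw [Set.ncard_eq_toFinset_card _ hAfin]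
    have key := card_mul_pow_add_pow_le_of_separated hAfin.toFinset c hδ hcase (by linarith)
      (fun y hy => ⟨((Set.Finite.mem_toFinset hAfin).1 hy).2.2,
        ((Set.Finite.mem_toFinset hAfin).1 hy).2.1⟩)
      (fun p hp q hq hpq => hsep p ((Set.Finite.mem_toFinset hAfin).1 hp).1 q
        ((Set.Finite.mem_toFinset hAfin).1 hq).1 hpq)
    rw [finrank_euclideanSpace_fin] at key
    have h0 : 0 ≤ L - ρ - δ / 2 := by linarith
    have hLδ : 0 ≤ L + δ / 2 := by positivity
    have f : (L + δ / 2) * (L - ρ - δ / 2) ≤ (L + δ / 2) ^ 2 := by nlinarith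
    have g : (L - ρ - δ / 2) ^ 2 ≤ (L + δ / 2) ^ 2 := by nlinarith
    have e : (L + δ / 2) ^ 3 - (L - ρ - δ / 2) ^ 3 =
        (ρ + δ) * ((L + δ / 2) ^ 2 + (L + δ / 2) * (L - ρ - δ / 2) + (L - ρ - δ / 2) ^ 2) := by
      ring
    have hρδ : 0 ≤ ρ + δ := by positivity
    have hin : (L + δ / 2) ^ 2 + (L + δ / 2) * (L - ρ - δ / 2) + (L - ρ - δ / 2) ^ 2 ≤
        3 * (L + δ / 2) ^ 2 := by linarith
    have k3 : ((hAfin.toFinset.card : ℕ) : ℝ) * (δ / 2) ^ 3 ≤ 3 * (ρ + δ) * (L + δ / 2) ^ 2 := by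
      linarith [mul_le_mul_of_nonneg_left hin hρδ]
    have hsq : (L + δ / 2) ^ 2 ≤ (1 + δ / 2) ^ 2 * (L + 1) ^ 2 := by
      rw [← mul_pow]
      exact pow_le_pow_left₀ hLδ (by nlinarith) 2
    have hcard : ((hAfin.toFinset.card : ℕ) : ℝ) ≤
        24 * (ρ + δ) * (1 + δ / 2) ^ 2 / δ ^ 3 * (L + 1) ^ 2 := by
      rw [div_mul_eq_mul_div, le_div_iff₀ (by positivity)]
      have e8 : ((hAfin.toFinset.card : ℕ) : ℝ) * δ ^ 3 =
          8 * (((hAfin.toFinset.card : ℕ) : ℝ) * (δ / 2) ^ 3) := by ring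
      rw [e8]
      nlinarith [mul_le_mul_of_nonneg_left hsq hρδ]
    nlinarith
  · -- ball packing
    have hlt : L - ρ < δ / 2 := not_le.1 hcase
    have hAle : (({y : E3 | y ∈ S ∧ dist y c ≤ L ∧ L - ρ < dist y c} : Set E3).ncard : ℝ) ≤
        ({y : E3 | y ∈ S ∧ dist y c ≤ L} : Set E3).ncard := by
      exact_mod_cast Set.ncard_le_ncard hAB hBfin
    have hball := ncard_ball_le hδ hsep c hL
    have hdiv : 2 * L / δ ≤ 2 * ρ / δ + 1 := by
      rw [div_le_iff₀ hδ, add_mul, div_mul_cancel₀ _ hδ.ne']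
      linarith
    have hmono : (2 * L / δ + 1) ^ 3 ≤ (2 * ρ / δ + 2) ^ 3 :=
      pow_le_pow_left₀ (by positivity) (by linarith) 3
    nlinarith

/-! ## (ii) The cross interaction across the sphere is a surface term -/

/-- **Depth-shell sum.** For an injective `δ`-separated configuration `x` in `ℝ³`, a centre `c`,
`L ≥ 0`, a set `S` of indices and integer depths `m j` with `m j ≤ L − dist (x j) c < m j + 1`
(`j ∈ S`): `Σ_{j ∈ S} 1024/(δ³ max(δ, m j)³) ≤ C(δ) (L+1)²` — the depth shell `m = k` holds
`≤ 24(1+δ)(L+δ/2)²/δ³` points (`card_shell_le`) and `Σ_k max(δ,k)⁻³ ≤ δ⁻³ + 2`; steps (2)–(4)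
of `exists_crossSum_le` verbatim. [folklore] -/
theorem sum_depth_le {δ : ℝ} (hδ : 0 < δ) {n : ℕ} {x : Fin n → E3} (hx : Function.Injective x)
    (hsep : ∀ i j : Fin n, i ≠ j → δ ≤ dist (x i) (x j)) (c : E3) {L : ℝ} (hL : 0 ≤ L)
    (S : Finset (Fin n)) (m : Fin n → ℕ)
    (hfloor : ∀ j ∈ S, ((m j : ℕ) : ℝ) ≤ L - dist (x j) c ∧ L - dist (x j) c < (m j : ℕ) + 1) :
    ∑ j ∈ S, 1024 / (δ ^ 3 * (max δ (m j : ℝ)) ^ 3) ≤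
      24 * (1 + δ) * (1 + δ / 2) ^ 2 / δ ^ 3 * (1024 / δ ^ 3 * ((δ⁻¹) ^ 3 + 2)) *
        (L + 1) ^ 2 := by
  classical
  have hxsep : ∀ (F : Finset (Fin n)), ∀ a ∈ F.image x, ∀ b ∈ F.image x, a ≠ b → δ ≤ dist a b := by
    intro F a ha b hb hab
    obtain ⟨l, -, rfl⟩ := Finset.mem_image.1 ha
    obtain ⟨l', -, rfl⟩ := Finset.mem_image.1 hb
    exact hsep l l' fun h => hab (h ▸ rfl)
  -- (2) regroup by shells and count each shell
  set t := S.image m with ht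
  have hmaps : ∀ j ∈ S, m j ∈ t := fun j hj => Finset.mem_image_of_mem m hj
  have step2 : ∑ j ∈ S, 1024 / (δ ^ 3 * (max δ (m j : ℝ)) ^ 3) = ∑ k ∈ t,
      ((S.filter fun j => m j = k).card : ℝ) * (1024 / (δ ^ 3 * (max δ (k : ℝ)) ^ 3)) := by
    have := Finset.sum_fiberwise_of_maps_to' hmaps
      (f := fun k : ℕ => 1024 / (δ ^ 3 * (max δ (k : ℝ)) ^ 3))
    simp only [Finset.sum_const, nsmul_eq_mul] at this
    exact this.symm
  have step3 : ∀ k ∈ t, ((S.filter fun j => m j = k).card : ℝ) ≤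
      24 * (1 + δ) * (L + δ / 2) ^ 2 / δ ^ 3 := by
    intro k hk
    obtain ⟨j₀, hj₀, hj₀k⟩ := Finset.mem_image.1 hk
    have hkL : (k : ℝ) ≤ L := by
      have h1 := (hfloor j₀ hj₀).1
      rw [hj₀k] at h1
      linarith [dist_nonneg (x := x j₀) (y := c)]
    rw [← Finset.card_image_of_injOn (hx.injOn (s := ((S.filter fun j => m j = k) : Set _)))]
    have := card_shell_le ((S.filter fun j => m j = k).image x) c hδ (b := L - k) (by linarith)
      ?_ (hxsep _)
    · refine this.trans ?_
      rw [div_le_div_iff_of_pos_right (by positivity)]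
      exact mul_le_mul_of_nonneg_left (pow_le_pow_left₀ (by linarith)
        (by linarith [(Nat.cast_nonneg k : (0 : ℝ) ≤ k)]) 2) (by positivity)
    · intro a ha
      obtain ⟨j, hj, rfl⟩ := Finset.mem_image.1 ha
      obtain ⟨hjS, hjk⟩ := Finset.mem_filter.1 hj
      obtain ⟨h1, h2⟩ := hfloor j hjS
      rw [hjk] at h1 h2
      constructor <;> linarith
  -- (3) `Σ_k max(δ,k)⁻³ ≤ δ⁻³ + 2`
  have step4 : ∑ k ∈ t, 1024 / (δ ^ 3 * (max δ (k : ℝ)) ^ 3) ≤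
      1024 / δ ^ 3 * ((δ⁻¹) ^ 3 + 2) := by
    have hw : ∀ k : ℕ, 1024 / (δ ^ 3 * (max δ (k : ℝ)) ^ 3) =
        1024 / δ ^ 3 * ((max δ (k : ℝ))⁻¹) ^ 3 := fun k => by
      rw [inv_pow, div_mul_eq_div_div, div_eq_mul_inv (1024 / δ ^ 3)]
    simp only [hw, ← Finset.mul_sum]
    refine mul_le_mul_of_nonneg_left ?_ (by positivity)
    have hsub : t ⊆ insert 0 (Finset.Ioo 0 (t.sup id + 1)) := by
      intro k hk
      rw [Finset.mem_insert, Finset.mem_Ioo]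
      rcases Nat.eq_zero_or_pos k with h | h
      · exact Or.inl h
      · exact Or.inr ⟨h, Nat.lt_succ_of_le (Finset.le_sup (f := id) hk)⟩
    have hIoo : ∀ k ∈ Finset.Ioo 0 (t.sup id + 1),
        ((max δ (k : ℝ))⁻¹) ^ 3 ≤ ((k : ℝ) ^ 2)⁻¹ := by
      intro k hk
      have hk1 : (1 : ℝ) ≤ k := by exact_mod_cast (Finset.mem_Ioo.1 hk).1
      calc ((max δ (k : ℝ))⁻¹) ^ 3 ≤ ((k : ℝ)⁻¹) ^ 3 :=
            pow_le_pow_left₀ (by positivity) (inv_anti₀ (by linarith) (le_max_right _ _)) 3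
        _ ≤ ((k : ℝ)⁻¹) ^ 2 :=
            pow_le_pow_of_le_one (by positivity) (inv_le_one_of_one_le₀ hk1) (by norm_num)
        _ = ((k : ℝ) ^ 2)⁻¹ := by rw [inv_pow]
    have hmax0 : ((max δ ((0 : ℕ) : ℝ))⁻¹) ^ 3 ≤ (δ⁻¹) ^ 3 :=
      pow_le_pow_left₀ (inv_nonneg.2 (hδ.le.trans (le_max_left _ _)))
        (inv_anti₀ hδ (le_max_left _ _)) 3
    have h2 : ∑ k ∈ Finset.Ioo 0 (t.sup id + 1), ((k : ℝ) ^ 2)⁻¹ ≤ 2 := by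
      simpa using sum_Ioo_inv_sq_le (α := ℝ) 0 (t.sup id + 1)
    calc ∑ k ∈ t, ((max δ (k : ℝ))⁻¹) ^ 3
        ≤ ∑ k ∈ insert 0 (Finset.Ioo 0 (t.sup id + 1)), ((max δ (k : ℝ))⁻¹) ^ 3 :=
          Finset.sum_le_sum_of_subset_of_nonneg hsub fun k _ _ => by positivity
      _ = ((max δ ((0 : ℕ) : ℝ))⁻¹) ^ 3 +
            ∑ k ∈ Finset.Ioo 0 (t.sup id + 1), ((max δ (k : ℝ))⁻¹) ^ 3 :=
          Finset.sum_insert (by simp)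
      _ ≤ (δ⁻¹) ^ 3 + ∑ k ∈ Finset.Ioo 0 (t.sup id + 1), ((k : ℝ) ^ 2)⁻¹ :=
          add_le_add hmax0 (Finset.sum_le_sum hIoo)
      _ ≤ (δ⁻¹) ^ 3 + 2 := by linarith
  -- (4) assembly
  have hL2 : (L + δ / 2) ^ 2 ≤ (1 + δ / 2) ^ 2 * (L + 1) ^ 2 := by
    rw [← mul_pow]
    exact pow_le_pow_left₀ (by positivity) (by nlinarith) 2
  calc ∑ j ∈ S, 1024 / (δ ^ 3 * (max δ (m j : ℝ)) ^ 3)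
      = ∑ k ∈ t, ((S.filter fun j => m j = k).card : ℝ) *
          (1024 / (δ ^ 3 * (max δ (k : ℝ)) ^ 3)) := step2
    _ ≤ ∑ k ∈ t, (24 * (1 + δ) * (L + δ / 2) ^ 2 / δ ^ 3) *
          (1024 / (δ ^ 3 * (max δ (k : ℝ)) ^ 3)) :=
        Finset.sum_le_sum fun k hk => mul_le_mul_of_nonneg_right (step3 k hk) (by positivity)
    _ ≤ (24 * (1 + δ) * (L + δ / 2) ^ 2 / δ ^ 3) * (1024 / δ ^ 3 * ((δ⁻¹) ^ 3 + 2)) := by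
        rw [← Finset.mul_sum]
        exact mul_le_mul_of_nonneg_left step4 (by positivity)
    _ ≤ (24 * (1 + δ) * ((1 + δ / 2) ^ 2 * (L + 1) ^ 2) / δ ^ 3) *
          (1024 / δ ^ 3 * ((δ⁻¹) ^ 3 + 2)) := by
        gcongr
    _ = _ := by ring

/-- **Site sum versus window sum.** For a `δ`-separated `S ⊆ ℝ³` and an injective enumeration
`x : Fin n → ℝ³` of the window `S ∩ B̄_L(c)`, the site sum of `x i` over all of `S` is at least
its window part `𝓔ⁱ(x) = Σ_{k ≠ i} V_LJ(|x i − x k|)` minus the attractive tail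
`(1/6)·1024/(δ³ max(δ, ⌊L − dist (x i) c⌋)³)`: the points of `S` outside the window are at
distance `≥ max(δ, ⌊depth⌋)` from `x i` (`neg_inv_pow_six_le_lennardJones`,
`sum_inv_pow_le_of_separated` on the finite partial sums of the summable site family). [folklore] -/
theorem siteEnergy_sub_le_tsum_site {S : Set E3} {δ : ℝ} (hδ : 0 < δ)
    (hsep : ∀ a ∈ S, ∀ b ∈ S, a ≠ b → δ ≤ dist a b) (c : E3) (L : ℝ)
    {n : ℕ} {x : Fin n → E3} (hx : Function.Injective x)
    (hrange : Set.range x = {y : E3 | y ∈ S ∧ dist y c ≤ L}) (i : Fin n) :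
    siteEnergy lennardJones x i -
        1 / 6 * (1024 / (δ ^ 3 * (max δ ((⌊L - dist (x i) c⌋₊ : ℕ) : ℝ)) ^ 3)) ≤
      ∑' z : ↥({z : E3 | z ∈ S ∧ z ≠ x i} : Set E3), lennardJones (dist (x i) (z : E3)) := by
  classical
  have hmem : ∀ k, x k ∈ S ∧ dist (x k) c ≤ L := fun k => by
    have h : x k ∈ Set.range x := Set.mem_range_self k
    rw [hrange] at h
    exact h
  have hxi : x i ∈ S := (hmem i).1
  set T : Set E3 := {z : E3 | z ∈ S ∧ z ≠ x i} with hT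
  have hs := summable_lennardJones_site hδ hsep hxi
  set G : Finset ↥T := ((Finset.univ.erase i).image x).subtype fun z => z ∈ T with hG
  -- the window part of the site sum is the site energy of `i` in `x`
  have hGsum : ∑ z ∈ G, lennardJones (dist (x i) (z : E3)) = siteEnergy lennardJones x i := by
    rw [siteEnergy, hG,
      Finset.sum_subtype_eq_sum_filter (f := fun z => lennardJones (dist (x i) z)),
      Finset.filter_true_of_mem, Finset.sum_image]
    · exact fun a _ b _ h => hx h
    · intro z hz
      obtain ⟨k, hk, rfl⟩ := Finset.mem_image.1 hz
      exact ⟨(hmem k).1, fun h => (Finset.mem_erase.1 hk).1 (hx h)⟩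
  -- outside the window the points are far from `x i`
  have hfar : ∀ z : ↥T, z ∉ G →
      max δ ((⌊L - dist (x i) c⌋₊ : ℕ) : ℝ) ≤ dist (z : E3) (x i) := by
    intro z hz
    have hzT : (z : E3) ∈ T := z.2
    have hzL : ¬ dist (z : E3) c ≤ L := by
      intro h
      have hzr : (z : E3) ∈ Set.range x := by
        rw [hrange]
        exact ⟨hzT.1, h⟩
      obtain ⟨k, hk⟩ := hzr
      refine hz (Finset.mem_subtype.2 (Finset.mem_image.2 ⟨k, ?_, hk⟩))
      exact Finset.mem_erase.2 ⟨fun hki => hzT.2 (by rw [← hk, hki]), Finset.mem_univ k⟩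
    refine max_le (hsep _ hzT.1 _ hxi hzT.2) ?_
    have hfl : ((⌊L - dist (x i) c⌋₊ : ℕ) : ℝ) ≤ L - dist (x i) c :=
      Nat.floor_le (sub_nonneg.2 (hmem i).2)
    linarith [not_le.1 hzL, dist_triangle (z : E3) (x i) c]
  -- pass to the limit along finite partial sums containing `G`
  refine ge_of_tendsto hs.hasSum (Filter.Eventually.filter_mono
    (SummationFilter.unconditional _).le_atTop (Filter.eventually_atTop.2 ⟨G, fun F hGF => ?_⟩))
  rw [← Finset.sum_sdiff hGF, hGsum]
  have h6 : ∑ z ∈ F \ G, (dist ((z : ↥T) : E3) (x i))⁻¹ ^ (3 + 3) ≤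
      1024 / (δ ^ 3 * (max δ ((⌊L - dist (x i) c⌋₊ : ℕ) : ℝ)) ^ 3) := by
    have h := sum_inv_pow_le_of_separated ((F \ G).image Subtype.val) (x i) (k := 3)
      (R := max δ ((⌊L - dist (x i) c⌋₊ : ℕ) : ℝ)) (by norm_num) hδ (le_max_left _ _) ?_ ?_
    · rwa [Finset.sum_image fun a _ b _ h => Subtype.ext h] at h
    · intro a ha b hb hab
      obtain ⟨a', -, rfl⟩ := Finset.mem_image.1 ha
      obtain ⟨b', -, rfl⟩ := Finset.mem_image.1 hb
      exact hsep _ a'.2.1 _ b'.2.1 hab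
    · intro a ha
      obtain ⟨z, hz, rfl⟩ := Finset.mem_image.1 ha
      exact hfar z (Finset.mem_sdiff.1 hz).2
  have h7 : ∀ z ∈ F \ G, -((1 / 6) * (dist ((z : ↥T) : E3) (x i))⁻¹ ^ (3 + 3)) ≤
      lennardJones (dist (x i) (z : E3)) := fun z _ => by
    rw [dist_comm]
    exact neg_inv_pow_six_le_lennardJones _
  have htail : -(1 / 6 * (1024 / (δ ^ 3 * (max δ ((⌊L - dist (x i) c⌋₊ : ℕ) : ℝ)) ^ 3))) ≤
      ∑ z ∈ F \ G, lennardJones (dist (x i) ((z : ↥T) : E3)) :=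
    calc -(1 / 6 * (1024 / (δ ^ 3 * (max δ ((⌊L - dist (x i) c⌋₊ : ℕ) : ℝ)) ^ 3)))
        ≤ -((1 / 6) * ∑ z ∈ F \ G, (dist ((z : ↥T) : E3) (x i))⁻¹ ^ (3 + 3)) := by linarith
      _ = ∑ z ∈ F \ G, -((1 / 6) * (dist ((z : ↥T) : E3) (x i))⁻¹ ^ (3 + 3)) := by
          rw [Finset.mul_sum, Finset.sum_neg_distrib]
      _ ≤ _ := Finset.sum_le_sum h7
  linarith

/-! ## The stub -/

/-- **Stub L (boundary layer of a separated set).** For `δ > 0`, `ρ ≥ 0` there is `C` such that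
for every `δ`-separated `S ⊆ ℝ³`, every centre `c` and radius `L ≥ 0`: (i) the points of
`S ∩ B̄_L(c)` at depth `< ρ` number at most `C(L+1)²` (`ncard_layer_le`); (ii) for every
injective enumeration `x` of `S ∩ B̄_L(c)`,
`2·𝓔_LJ(x) − C(L+1)² ≤ Σ_{y ∈ S ∩ B̄_L(c)} Σ'_{z ∈ S, z ≠ y} V_LJ(|y − z|)` (the outer `tsum` is
the finite sum over `i : Fin n`; sitewise `siteEnergy_sub_le_tsum_site`, double counting
`two_mul_interactionEnergy`, and the depth-shell sum `sum_depth_le`). [folklore] -/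
theorem stub_boundaryLayer : ∀ δ : ℝ, 0 < δ → ∀ ρ : ℝ, 0 ≤ ρ → ∃ C : ℝ, ∀ S : Set (EuclideanSpace ℝ (Fin 3)), (∀ y ∈ S, ∀ z ∈ S, y ≠ z → δ ≤ dist y z) → ∀ (c : EuclideanSpace ℝ (Fin 3)) (L : ℝ), 0 ≤ L → (({y : EuclideanSpace ℝ (Fin 3) | y ∈ S ∧ dist y c ≤ L ∧ L - ρ < dist y c} : Set (EuclideanSpace ℝ (Fin 3))).ncard : ℝ) ≤ C * (L + 1) ^ 2 ∧ ∀ (n : ℕ) (x : Fin n → EuclideanSpace ℝ (Fin 3)), Function.Injective x → Set.range x = {y : EuclideanSpace ℝ (Fin 3) | y ∈ S ∧ dist y c ≤ L} → 2 * Literature.MathematicalPhysics.StatisticalMechanics.interactionEnergy Literature.MathematicalPhysics.StatisticalMechanics.lennardJones x - C * (L + 1) ^ 2 ≤ (∑' y : ↥{y : EuclideanSpace ℝ (Fin 3) | y ∈ S ∧ dist y c ≤ L}, (∑' z : ↥{z : EuclideanSpace ℝ (Fin 3) | z ∈ S ∧ z ≠ (y : EuclideanSpace ℝ (Fin 3))},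 Literature.MathematicalPhysics.StatisticalMechanics.lennardJones (dist (y : EuclideanSpace ℝ (Fin 3)) (z : EuclideanSpace ℝ (Fin 3))))) := by
  classical
  intro δ hδ ρ hρ
  set C₁ : ℝ := 24 * (ρ + δ) * (1 + δ / 2) ^ 2 / δ ^ 3 + (2 * ρ / δ + 2) ^ 3 with hC₁
  set C₂ : ℝ := 24 * (1 + δ) * (1 + δ / 2) ^ 2 / δ ^ 3 * (1024 / δ ^ 3 * ((δ⁻¹) ^ 3 + 2))
    with hC₂
  have hC₁0 : 0 ≤ C₁ := by positivity
  have hC₂0 : 0 ≤ C₂ := by positivity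
  refine ⟨C₁ + 1 / 6 * C₂, fun S hsep c L hL => ⟨?_, ?_⟩⟩
  · have hL2 : 0 ≤ (L + 1) ^ 2 := by positivity
    calc (({y : E3 | y ∈ S ∧ dist y c ≤ L ∧ L - ρ < dist y c} : Set E3).ncard : ℝ)
        ≤ C₁ * (L + 1) ^ 2 := ncard_layer_le hδ hsep hρ c hL
      _ ≤ (C₁ + 1 / 6 * C₂) * (L + 1) ^ 2 := by nlinarith
  · intro n x hx hrange
    have hmem : ∀ k, x k ∈ S ∧ dist (x k) c ≤ L := fun k => by
      have h : x k ∈ Set.range x := Set.mem_range_self k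
      rw [hrange] at h
      exact h
    -- the outer `tsum` is the finite sum over `i : Fin n`
    set f : E3 → ℝ := fun y =>
      ∑' z : ↥({z : E3 | z ∈ S ∧ z ≠ y} : Set E3), lennardJones (dist y (z : E3)) with hf
    have houter : ∑' y : ↥({y : E3 | y ∈ S ∧ dist y c ≤ L} : Set E3), f y = ∑ i, f (x i) := by
      rw [← tsum_congr_set_coe f hrange, tsum_range f hx, tsum_fintype]
    change 2 * interactionEnergy lennardJones x - (C₁ + 1 / 6 * C₂) * (L + 1) ^ 2 ≤
      ∑' y : ↥({y : E3 | y ∈ S ∧ dist y c ≤ L} : Set E3), f y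
    rw [houter]
    -- sitewise lower bound, summed
    have hsum : ∑ i, (siteEnergy lennardJones x i -
        1 / 6 * (1024 / (δ ^ 3 * (max δ ((⌊L - dist (x i) c⌋₊ : ℕ) : ℝ)) ^ 3))) ≤
        ∑ i, f (x i) :=
      Finset.sum_le_sum fun i _ => siteEnergy_sub_le_tsum_site hδ hsep c L hx hrange i
    rw [Finset.sum_sub_distrib, ← Finset.mul_sum, ← two_mul_interactionEnergy] at hsum
    -- the tails sum to a surface term
    have hxsep : ∀ i j : Fin n, i ≠ j → δ ≤ dist (x i) (x j) := fun i j hij =>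
      hsep _ (hmem i).1 _ (hmem j).1 fun h => hij (hx h)
    have htail : ∑ i, 1024 / (δ ^ 3 * (max δ ((⌊L - dist (x i) c⌋₊ : ℕ) : ℝ)) ^ 3) ≤
        C₂ * (L + 1) ^ 2 :=
      sum_depth_le hδ hx hxsep c hL Finset.univ (fun j => ⌊L - dist (x j) c⌋₊) fun j _ =>
        ⟨Nat.floor_le (sub_nonneg.2 (hmem j).2), Nat.lt_floor_add_one _⟩
    nlinarith
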